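/-
Copyright (c) 2026 the pub-hodgecm-mathlib formalisation cell (harness21).  Prover seat hodgecm-mathlib-K2E3-p32 (g0), HCML Track B «K2-LIT» (close-out strike line L4
`stub_StCharTS`), h413 = `stmt-HodgeConjecture-24833`, line `K2_E3_EllipticInputs`, unit U4 «Keys», PART «U4Keys» socket :155 (U4f-χ₁-ram-one-d0B)
`sig_K2E3KeysThmTwoContractingRamifiedCharOneDepthZeroNormTrivial` (LINE-LEAD K2E3-plan (g5), deal D162 «d0B lead ∕ consumer», cell «U4-RAM»; Z3-c SHARED FRAME v1 (K2E3-p03 (g9));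
step (II)-c part 1 «THE TWO BIG-CELL ENTRIES AS SET INTEGRALS OF `F₀`» (part 2 = `K2E3BranchBCasselmanPairClosedForms`: closed forms + heads), R0 head bytes of R90-C10-p01 (g2) 16:54:22Z, typed by the d0B lead after the cell's seats
closed (16:57Z) without filing it).  2026-09-04.
-/
import Summits.HodgeConjecture.HodgeConjecture.Theorems.K2E3BranchBCasselmanPairIntegrands       -- ★ (I) p861988 (K2E3-p03 (g9)): the pointwise values off∕on `N₀` (`toFun_weyl_mul_eq_of_one_lt_v`, `…_eq_zero_of_v_le_one`, `toFun_conj_weyl_eq_of_one_le_v`, `…_eq_zero_of_v_lt_one`)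
import Summits.HodgeConjecture.HodgeConjecture.Theorems.K2E3KeysThmTwoDepthZeroBranchBFromDet     -- ★ (this seat) the d0B end assembly from `det M = 0` (for the head shapes `h11v`, `hwwv`); brings ★ Constants, the frame
import Mathlib.MeasureTheory.Integral.Bochner.Basic
import HarnessLib

/-!
# K2 ∕ E3 «EllipticInputs», unit U4 «Keys» — (U4f-χ₁-ram-one-d0B) step (II)-c: THE TWO BIG-CELL ENTRIES OF THE CASSELMAN PAIR AS SET INTEGRALS OF THE FRAME-v1 INTEGRAND `F₀`,
# THEIR INTEGRABILITY, THE CLOSED FORMS `c·Y∕(1+Y)`, `−c∕(1+Y)` FROM THE SHELL IDENTITIES, AND THE HEADS `h11v`, `hwwv` OF THE END ASSEMBLY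
# [Casselman1980 §3; Casselman1995 §6.4; Keys1984 §7 Thm (2); Rogawski1990 §12.1–§12.2]

Cell `pub/hodgecm-mathlib`, crux H413 = `stmt-HodgeConjecture-24833`, route of record `HCCMUnconditional`; chair K2-lead (g2), LINE-LEAD∕dealer K2E3-plan (g5), architect K2E3-p25
(g3); cell «U4-RAM» (Z3-c frame v1 `K2/K2E3-p03/g9/Z3c-frame.v1.txt`, K2E3-p03 (g9); (II)-c dealt to R90-C10-p01 (g2) 16:51:43Z, R0 16:54:22Z, seat closed before GREEN — typed here
on exactly those heads by the consumer).  THEOREMS ONLY (no `def`, no `instance`, no `notation`, no named-fact hypothesis, no `sorry`); lane `--supports stmt-HodgeConjecture-24833 --as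
helper`, count-neutral.  NOT THE PAYER: the three SHELL IDENTITIES (`hscal`, `h1` = (II)-a `K2E3BranchBShellScaling`; `h0` = (II)-b3 `K2E3BranchBShellZero`), `IntegrableOn F₀ S_ge` and the
Borel-ness of the regions stay hypotheses (frame-v1 heads, verbatim up to the carrier spelling `↥(cmBorelTriple L 3 v).N = ↥(unipotentU σ J)` (`rfl`)).

THE POINT.  ★ (I) `K2E3BranchBCasselmanPairIntegrands` computes, for an `(I, θ)`-eigen-section `f` of `i(χ₁, χ₂)` on `U(Φ₃)(L⁺_v)`, `f(w₀u)` and `f(w₀uw₀)` pointwise in terms of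
`z = u₀₂`: off the small regions they are `χ₁((σz)⁻¹)·χ₂(−1)·‖z‖⁻¹` times `f(1)` resp. `f(w₀)`, and `0` on them for the normalised vectors.  With `θ(b) = χ₁(b₀₀)` (depth zero; `hθ1`
discharged: `θ = 1` at `b₀₀ = 1`) and the frame-v1 integrand `F₀(n) = χ₁((σz)⁻¹)·‖z‖⁻¹` (the `dite` on `IsUnit z`, value `0` off the units), this file reads the two BIG-CELL entries as
SET INTEGRALS — `Λ_1 f₁ = χ₂(−1)·f₁(1)·∫_{S_gt} F₀`, `Λ_{w₀} f_w = χ₂(−1)·f_w(w₀)·∫_{S_ge} F₀` (`S_gt = {|z|_w > 1}`, `S_ge = {|z|_w ≥ 1}`) — with their integrability from `IntegrableOn F₀`,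
proves the two CLOSED FORMS of PAPER-Z3 §1 from the shell identities as pure algebra, identifies `N₀ = {|z|_w ≤ 1} = {n ∈ I}`, and delivers the heads `h11v`, `hwwv` (and `hi₁₁`, `hiw₂`) of ★
`K2E3KeysThmTwoDepthZeroBranchBFromDet` ∕ ★ `…Assembly` in their exact shapes:
* §1 `theta_eq_one_of_apply_eq_one` (`hθ1` for `θ(b) = χ₁(b₀₀)`), `chi2_neg_one_sq` (`χ₂(−1)² = 1`), `setOf_v_le_one_eq_setOf_mem` (`{|z|_w ≤ 1} = {n ∈ I}`).
* §2 `toFun_weyl_mul_eq_mul_indicator` (`f(w₀) = 0`: `f(w₀n) = χ₂(−1)f(1)·𝟙_{S_gt}F₀(n)`), `toFun_conj_weyl_eq_mul_indicator` (`f(1) = 0`: `f(w₀nw₀) = χ₂(−1)f(w₀)·𝟙_{S_ge}F₀(n)`).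
* §3 `integral_toFun_weyl_mul_eq`, `integrable_toFun_weyl_mul`, `integral_toFun_conj_weyl_eq`, `integrable_toFun_conj_weyl`.
* §4 (algebra) `closedForm_ge` (`Ige = I0 + I1 + Y²·Ige`, `I1 = c·Y`, `I0 = −c`, `|Y| < 1` ⟹ `Ige = −c∕(1+Y)`), `closedForm_gt` (`Ige − I0 = c·Y∕(1+Y)`).
* §5 **`integral_weyl_one_eq_of_shells`** (`h11v`) and **`integral_weyl_weyl_eq_of_shells`** (`hwwv`) for the normalised basis vectors, from the three shell identities.
HONEST LABEL.  HC_CM is proved only modulo the 7 printed citations (2 remaining named inputs: hLiu418 = `stmt-HodgeConjecture-24832`, h413 = `stmt-HodgeConjecture-24833`) until rung 0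
closes; count-neutral — this file does NOT pay the leaf; no printed citation is discharged.

## References
* [Casselman1980] W. Casselman, Compositio Math. 40 (1980), §3 (the intertwining functionals on the Iwahori-type vectors).
* [Casselman1995] W. Casselman, *Introduction to the theory of admissible representations of `p`-adic reductive groups* (1995), §6.4 (rank-one intertwining integrals).
* [Keys1984] D. Keys, Compositio Math. 51 (1984), §7 Theorem (2) p. 126.
* [Rogawski1990] J. Rogawski, Ann. of Math. Stud. 123 (1990), §12.1 p. 171, §12.2 p. 173.
-/

set_option autoImplicit false
-- the mandated namespace has the single-problem summit's repeated segment (`HodgeConjecture.HodgeConjecture`)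
set_option linter.dupNamespace false

noncomputable section

open NumberField IsDedekindDomain MeasureTheory
open scoped Matrix MatrixGroups WithZero Valued NNReal
open Literature.NumberTheory Literature.NumberTheory.Automorphic Literature.NumberTheory.Automorphic.UnitaryGroup
open Literature.NumberTheory.Rogawski1990

namespace Summit.HodgeConjecture.HodgeConjecture.Cruxes.H413.K2E3BranchBCasselmanPairEntries

open Summit.HodgeConjecture.HodgeConjecture.Cruxes.H413
open Summit.HodgeConjecture.HodgeConjecture.Cruxes.H413.K2E3DepthZeroIwahoriCharacterCM
open Summit.HodgeConjecture.HodgeConjecture.Cruxes.H413.K2E3BranchATorusWitnessCM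
open Summit.HodgeConjecture.HodgeConjecture.Cruxes.H413.K2E3BranchBCellFunctionsCM

variable (L : Type) [Field L] [NumberField L] [IsCMField L] (v : HeightOneSpectrum (𝓞 ↥(maximalRealSubfield L)))
  (w : PlacesOver L v) (hw : IsCMField.complexConj L • w.1 = w.1)
  (eA : Gqs L v ≃ₜ* ↥(unitaryGroupOfForm (galAdicCompletionMap (L := L) (IsCMField.complexConj L) hw) ((StdForm.antidiagonal 3).over (w.1.adicCompletion L))))
  (heA : ∀ g : Gqs L v,
    ((eA g : ↥(unitaryGroupOfForm (galAdicCompletionMap (L := L) (IsCMField.complexConj L) hw) ((StdForm.antidiagonal 3).over (w.1.adicCompletion L)))) :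
        GL (Fin 3) (w.1.adicCompletion L)) =
      ((localNonsplitEquiv (IsCMField.complexConj L) (qsForm L) (IsCMField.complexConj_ne_one L) w hw g :
        ↥(unitaryGroupOfForm (galAdicCompletionMap (L := L) (IsCMField.complexConj L) hw) (placeForm (qsForm L) w.1))) : GL (Fin 3) (w.1.adicCompletion L)))
  {ϖ : w.1.adicCompletion L} (hϖ : Valued.v ϖ = WithZero.exp (-1 : ℤ))
  (g₁ : GL (Fin 3) (w.1.adicCompletion L)) (hg₁ : (g₁ : Matrix (Fin 3) (Fin 3) (w.1.adicCompletion L)) = Matrix.diagonal ![(1 : w.1.adicCompletion L), 1, ϖ])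
  (K0 K1 I : Subgroup (Gqs L v))
  (hK0 : K0 = ((glInt 3 (w.1.adicCompletion L)).subgroupOf
    (unitaryGroupOfForm (galAdicCompletionMap (L := L) (IsCMField.complexConj L) hw) ((StdForm.antidiagonal 3).over (w.1.adicCompletion L)))).comap
      eA.toMulEquiv.toMonoidHom)
  (hK1 : K1 = (((glInt 3 (w.1.adicCompletion L)).map (MulAut.conj g₁).toMonoidHom).subgroupOf
    (unitaryGroupOfForm (galAdicCompletionMap (L := L) (IsCMField.complexConj L) hw) ((StdForm.antidiagonal 3).over (w.1.adicCompletion L)))).comap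
      eA.toMulEquiv.toMonoidHom)
  (hI : I = K0 ⊓ K1)
  (w₀ : ↥(unitaryGroupOfForm (conjLocal L (IsCMField.complexConj L) v) (cmLocalForm L 3 v))) (hw₀ : Units.val (w₀ : GL (Fin 3) (LocalRing L v)) = cmLocalForm L 3 v)
  (χ₁ : (LocalRing L v)ˣ →* ℂˣ) (χ₂ : ↥(normOneUnits (conjLocal L (IsCMField.complexConj L) v)) →* ℂˣ)

/-! ## §1 Letters: `hθ1` for `θ(b) = χ₁(b₀₀)`, `χ₂(−1)² = 1`, `N₀ = {|z|_w ≤ 1} = {n ∈ I}` -/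

open Classical in
/-- `θ(b) = χ₁(b₀₀)` (the `dite` on `IsUnit b₀₀`) equals `1` whenever `b₀₀ = 1` — the letter `hθ1` of ★ (I). [cite: Keys1984, §7] -/
theorem theta_eq_one_of_apply_eq_one (g : Gqs L v) (h00 : ((g.val : GL (Fin 3) (LocalRing L v)) : Matrix (Fin 3) (Fin 3) (LocalRing L v)) 0 0 = 1) :
    (fun g : Gqs L v => if h : IsUnit (((g.val : GL (Fin 3) (LocalRing L v)) : Matrix (Fin 3) (Fin 3) (LocalRing L v)) 0 0) then ((χ₁ h.unit : ℂˣ) : ℂ) else 0) g = 1 := by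
  have h1 : IsUnit (((g.val : GL (Fin 3) (LocalRing L v)) : Matrix (Fin 3) (Fin 3) (LocalRing L v)) 0 0) := by rw [h00]; exact isUnit_one
  simp only [dif_pos h1]
  have hu : h1.unit = 1 := Units.ext (by rw [IsUnit.unit_spec, h00, Units.val_one])
  rw [hu, map_one, Units.val_one]

/-- **`χ₂(−1)² = 1`** (`(−1)² = 1` in `U(1)`) — the letter `hc` (`c₂ = χ₂(−1)`) of ★ `K2E3KeysThmTwoDepthZeroBranchBFromDet`. [cite: Keys1984, §7] -/
theorem chi2_neg_one_sq : ((χ₂ ⟨-1, F0P3cStCharTSBigCellFactorisation.neg_one_mem_normOneUnits (conjLocal L (IsCMField.complexConj L) v)⟩ : ℂˣ) : ℂ) ^ 2 = 1 := by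
  rw [← Units.val_pow_eq_pow_val, ← map_pow]
  have h : (⟨-1, F0P3cStCharTSBigCellFactorisation.neg_one_mem_normOneUnits (conjLocal L (IsCMField.complexConj L) v)⟩ :
      ↥(normOneUnits (conjLocal L (IsCMField.complexConj L) v))) ^ 2 = 1 := Subtype.ext (by
    rw [SubmonoidClass.coe_pow, OneMemClass.coe_one]; exact neg_one_sq)
  rw [h, map_one, Units.val_one]

include hw heA hϖ hg₁ hK0 hK1 hI in
/-- **`N₀ = {n : |z(n)|_w ≤ 1} = {n : n ∈ I}`** as subsets of `N(L⁺_v)` (★ Z3-a `exists_coe_eA_eq_upper`, `mem_iff_v_le_one`, ★ `coe_eA_apply`): the frame-v1 volume `V = μ(N₀)` is the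
`μ.real {n ∈ I}` of ★ PairConstants ∕ ★ Constants. [cite: Rogawski1990, §1.10 p. 9] [cite: Keys1984, §7] -/
theorem setOf_v_le_one_eq_setOf_mem : {m : ↥(cmBorelTriple L 3 v).N | Valued.v (((((m : ↥(unitaryGroupOfForm (conjLocal L (IsCMField.complexConj L) v) (cmLocalForm L 3 v))) : GL (Fin 3) (LocalRing L v)) : Matrix (Fin 3) (Fin 3) (LocalRing L v)) 0 2) w) ≤ 1} = {m : ↥(cmBorelTriple L 3 v).N | (m : ↥(unitaryGroupOfForm (conjLocal L (IsCMField.complexConj L) v) (cmLocalForm L 3 v))) ∈ I} := by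
  ext n
  obtain ⟨x, z, hux, hrel⟩ := exists_coe_eA_eq_upper L v w hw eA heA (cmBorelTriple L 3 v) rfl n.2
  have hz02 : ((((n : ↥(unitaryGroupOfForm (conjLocal L (IsCMField.complexConj L) v) (cmLocalForm L 3 v))) : GL (Fin 3) (LocalRing L v)) : Matrix (Fin 3) (Fin 3) (LocalRing L v)) 0 2) w = z := by
    rw [← coe_eA_apply L v w hw eA heA (n : ↥(unitaryGroupOfForm (conjLocal L (IsCMField.complexConj L) v) (cmLocalForm L 3 v))) 0 2, hux]; rfl
  simp only [Set.mem_setOf_eq]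
  rw [hz02]
  exact (mem_iff_v_le_one L v w hw eA hϖ g₁ hg₁ K0 K1 I hK0 hK1 hI hux hrel).symm

/-! ## §2 The pointwise readings as indicators -/

open Classical in
include hw heA hϖ hg₁ hK0 hK1 hI hw₀ in
set_option maxHeartbeats 1600000 in
set_option synthInstance.maxHeartbeats 400000 in
-- two carriers (`Gqs L v` and the matrix subgroup), slow unification (class of ★ (I))
/-- **`f(w₀ n) = χ₂(−1)·f(1)·𝟙_{S_gt}(n)·F₀(n)`** for an `(I, χ̃)`-eigen-section `f` with `f(w₀) = 0` (the normalised `f₁`): off `S_gt = {|z|_w > 1}` ★ (I) `toFun_weyl_mul_eq_zero_of_v_le_one`,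
on it `z` is a unit (★ `isUnit_of_apply_ne_zero`) and ★ (I) `toFun_weyl_mul_eq_of_one_lt_v` reads `χ₁((σz)⁻¹)·χ₂(−1)·‖z‖⁻¹·f(1)`. [cite: Casselman1980, §3] [cite: Keys1984, §7 Theorem (2) p. 126] -/
theorem toFun_weyl_mul_eq_mul_indicator
    (f : haveI := locallyCompactSpace_cmBorelU L 3 v
      Representation.SmoothInd (cmBorelTriple L 3 v).P
        (Representation.twist (((Representation.trivial ℂ ↥(torusU (conjLocal L (IsCMField.complexConj L) v) (cmLocalForm L 3 v)) ℂ).twist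
            (cmTorusCharPair L v χ₁ χ₂)).comp (cmBorelTriple L 3 v).proj) (rootDeltaChar (cmBorelTriple L 3 v).P)))
    (heig : haveI := locallyCompactSpace_cmBorelU L 3 v
      ∀ j ∈ I, Representation.smoothIndRep (cmBorelTriple L 3 v).P _ j f =
        (fun g : Gqs L v => if h : IsUnit (((g.val : GL (Fin 3) (LocalRing L v)) : Matrix (Fin 3) (Fin 3) (LocalRing L v)) 0 0) then ((χ₁ h.unit : ℂˣ) : ℂ) else 0) j • f)
    (h1g : f.toFun w₀ = 0) (n : ↥(cmBorelTriple L 3 v).N) :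
    f.toFun (w₀ * (n : ↥(unitaryGroupOfForm (conjLocal L (IsCMField.complexConj L) v) (cmLocalForm L 3 v)))) = (((χ₂ ⟨-1, F0P3cStCharTSBigCellFactorisation.neg_one_mem_normOneUnits (conjLocal L (IsCMField.complexConj L) v)⟩ : ℂˣ) : ℂ) * f.toFun 1) * Set.indicator {m : ↥(cmBorelTriple L 3 v).N | 1 < Valued.v (((((m : ↥(unitaryGroupOfForm (conjLocal L (IsCMField.complexConj L) v) (cmLocalForm L 3 v))) : GL (Fin 3) (LocalRing L v)) : Matrix (Fin 3) (Fin 3) (LocalRing L v)) 0 2) w)}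
      (fun n : ↥(cmBorelTriple L 3 v).N =>
        if h : IsUnit ((((n : ↥(unitaryGroupOfForm (conjLocal L (IsCMField.complexConj L) v) (cmLocalForm L 3 v))) : GL (Fin 3) (LocalRing L v)) : Matrix (Fin 3) (Fin 3) (LocalRing L v)) 0 2) then
          ((((χ₁ (Units.map ((conjLocal L (IsCMField.complexConj L) v) : LocalRing L v →* LocalRing L v) h.unit))⁻¹ : ℂˣ) : ℂ) *
            ((((unitModulusChar (LocalRing L v) h.unit)⁻¹ : ℝ≥0) : ℝ) : ℂ))
        else 0) n := by
  haveI := locallyCompactSpace_cmBorelU L 3 v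
  by_cases hz : 1 < Valued.v (((((n : ↥(unitaryGroupOfForm (conjLocal L (IsCMField.complexConj L) v) (cmLocalForm L 3 v))) : GL (Fin 3) (LocalRing L v)) : Matrix (Fin 3) (Fin 3) (LocalRing L v)) 0 2) w)
  · have hb : IsUnit ((((n : ↥(unitaryGroupOfForm (conjLocal L (IsCMField.complexConj L) v) (cmLocalForm L 3 v))) : GL (Fin 3) (LocalRing L v)) : Matrix (Fin 3) (Fin 3) (LocalRing L v)) 0 2) :=
      isUnit_of_apply_ne_zero L v w hw _ (fun h0 => by rw [h0, map_zero] at hz; exact not_lt_zero hz)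
    have hval := K2E3BranchBCasselmanPairIntegrands.toFun_weyl_mul_eq_of_one_lt_v L v w hw eA heA hϖ g₁ hg₁ K0 K1 I hK0 hK1 hI w₀ hw₀ χ₁ χ₂ _
      (fun g _ h00 => theta_eq_one_of_apply_eq_one L v χ₁ g h00) f heig n.2 hb hz
    rw [Set.indicator_of_mem (show n ∈ {m : ↥(cmBorelTriple L 3 v).N | 1 < Valued.v (((((m : ↥(unitaryGroupOfForm (conjLocal L (IsCMField.complexConj L) v) (cmLocalForm L 3 v))) : GL (Fin 3) (LocalRing L v)) : Matrix (Fin 3) (Fin 3) (LocalRing L v)) 0 2) w)} from hz)]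
    simp only [dif_pos hb]
    refine hval.trans ?_
    ring
  · rw [Set.indicator_of_notMem (show n ∉ {m : ↥(cmBorelTriple L 3 v).N | 1 < Valued.v (((((m : ↥(unitaryGroupOfForm (conjLocal L (IsCMField.complexConj L) v) (cmLocalForm L 3 v))) : GL (Fin 3) (LocalRing L v)) : Matrix (Fin 3) (Fin 3) (LocalRing L v)) 0 2) w)} from hz), mul_zero]
    exact K2E3BranchBCasselmanPairIntegrands.toFun_weyl_mul_eq_zero_of_v_le_one L v w hw eA heA hϖ g₁ hg₁ K0 K1 I hK0 hK1 hI w₀ χ₁ χ₂ _ f heig h1g n.2 (not_lt.1 hz)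

open Classical in
include hw heA hϖ hg₁ hK0 hK1 hI hw₀ in
set_option maxHeartbeats 1600000 in
set_option synthInstance.maxHeartbeats 400000 in
-- as above
/-- **`f(w₀ n w₀) = χ₂(−1)·f(w₀)·𝟙_{S_ge}(n)·F₀(n)`** for an `(I, χ̃)`-eigen-section `f` with `f(1) = 0` (the normalised `f_w`): off `S_ge = {|z|_w ≥ 1}` ★ (I)
`toFun_conj_weyl_eq_zero_of_v_lt_one`, on it ★ (I) `toFun_conj_weyl_eq_of_one_le_v`. [cite: Casselman1980, §3] [cite: Keys1984, §7 Theorem (2) p. 126] -/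
theorem toFun_conj_weyl_eq_mul_indicator
    (f : haveI := locallyCompactSpace_cmBorelU L 3 v
      Representation.SmoothInd (cmBorelTriple L 3 v).P
        (Representation.twist (((Representation.trivial ℂ ↥(torusU (conjLocal L (IsCMField.complexConj L) v) (cmLocalForm L 3 v)) ℂ).twist
            (cmTorusCharPair L v χ₁ χ₂)).comp (cmBorelTriple L 3 v).proj) (rootDeltaChar (cmBorelTriple L 3 v).P)))
    (heig : haveI := locallyCompactSpace_cmBorelU L 3 v
      ∀ j ∈ I, Representation.smoothIndRep (cmBorelTriple L 3 v).P _ j f =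
        (fun g : Gqs L v => if h : IsUnit (((g.val : GL (Fin 3) (LocalRing L v)) : Matrix (Fin 3) (Fin 3) (LocalRing L v)) 0 0) then ((χ₁ h.unit : ℂˣ) : ℂ) else 0) j • f)
    (hw1 : f.toFun 1 = 0) (n : ↥(cmBorelTriple L 3 v).N) :
    f.toFun (w₀ * (n : ↥(unitaryGroupOfForm (conjLocal L (IsCMField.complexConj L) v) (cmLocalForm L 3 v))) * w₀) = (((χ₂ ⟨-1, F0P3cStCharTSBigCellFactorisation.neg_one_mem_normOneUnits (conjLocal L (IsCMField.complexConj L) v)⟩ : ℂˣ) : ℂ) * f.toFun w₀) * Set.indicator {m : ↥(cmBorelTriple L 3 v).N | 1 ≤ Valued.v (((((m : ↥(unitaryGroupOfForm (conjLocal L (IsCMField.complexConj L) v) (cmLocalForm L 3 v))) : GL (Fin 3) (LocalRing L v)) : Matrix (Fin 3) (Fin 3) (LocalRing L v)) 0 2) w)}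
      (fun n : ↥(cmBorelTriple L 3 v).N =>
        if h : IsUnit ((((n : ↥(unitaryGroupOfForm (conjLocal L (IsCMField.complexConj L) v) (cmLocalForm L 3 v))) : GL (Fin 3) (LocalRing L v)) : Matrix (Fin 3) (Fin 3) (LocalRing L v)) 0 2) then
          ((((χ₁ (Units.map ((conjLocal L (IsCMField.complexConj L) v) : LocalRing L v →* LocalRing L v) h.unit))⁻¹ : ℂˣ) : ℂ) *
            ((((unitModulusChar (LocalRing L v) h.unit)⁻¹ : ℝ≥0) : ℝ) : ℂ))
        else 0) n := by
  haveI := locallyCompactSpace_cmBorelU L 3 v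
  by_cases hz : 1 ≤ Valued.v (((((n : ↥(unitaryGroupOfForm (conjLocal L (IsCMField.complexConj L) v) (cmLocalForm L 3 v))) : GL (Fin 3) (LocalRing L v)) : Matrix (Fin 3) (Fin 3) (LocalRing L v)) 0 2) w)
  · have hb : IsUnit ((((n : ↥(unitaryGroupOfForm (conjLocal L (IsCMField.complexConj L) v) (cmLocalForm L 3 v))) : GL (Fin 3) (LocalRing L v)) : Matrix (Fin 3) (Fin 3) (LocalRing L v)) 0 2) :=
      isUnit_of_apply_ne_zero L v w hw _ (fun h0 => by rw [h0, map_zero] at hz; exact not_lt.2 hz zero_lt_one)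
    have hval := K2E3BranchBCasselmanPairIntegrands.toFun_conj_weyl_eq_of_one_le_v L v w hw eA heA hϖ g₁ hg₁ K0 K1 I hK0 hK1 hI w₀ hw₀ χ₁ χ₂ _
      (fun g _ h00 => theta_eq_one_of_apply_eq_one L v χ₁ g h00) f heig n.2 hb hz
    rw [Set.indicator_of_mem (show n ∈ {m : ↥(cmBorelTriple L 3 v).N | 1 ≤ Valued.v (((((m : ↥(unitaryGroupOfForm (conjLocal L (IsCMField.complexConj L) v) (cmLocalForm L 3 v))) : GL (Fin 3) (LocalRing L v)) : Matrix (Fin 3) (Fin 3) (LocalRing L v)) 0 2) w)} from hz)]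
    simp only [dif_pos hb]
    refine hval.trans ?_
    ring
  · rw [Set.indicator_of_notMem (show n ∉ {m : ↥(cmBorelTriple L 3 v).N | 1 ≤ Valued.v (((((m : ↥(unitaryGroupOfForm (conjLocal L (IsCMField.complexConj L) v) (cmLocalForm L 3 v))) : GL (Fin 3) (LocalRing L v)) : Matrix (Fin 3) (Fin 3) (LocalRing L v)) 0 2) w)} from hz), mul_zero]
    exact K2E3BranchBCasselmanPairIntegrands.toFun_conj_weyl_eq_zero_of_v_lt_one L v w hw eA heA hϖ g₁ hg₁ K0 K1 I hK0 hK1 hI w₀ hw₀ χ₁ χ₂ _ f heig hw1 n.2 (not_le.1 hz)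

/-! ## §3 The two entries as set integrals of `F₀`, and their integrability -/

open Classical in
include hw heA hϖ hg₁ hK0 hK1 hI hw₀ in
set_option maxHeartbeats 1600000 in
set_option synthInstance.maxHeartbeats 400000 in
-- as in §2
/-- **`Λ_1 f = ∫_N f(w₀ n) dμ = χ₂(−1)·f(1)·∫_{S_gt} F₀ dμ`** for `f(w₀) = 0` (`S_gt` Borel): §2 + `∫ 𝟙_S F₀ = ∫_S F₀`.  (Integrand spelled `f(w₀ · n · 1)`, the shape of ★
`K2E3BranchBDeterminantZeroDepthZero` ∕ ★ `…FromDet`.) [cite: Casselman1980, §3] [cite: Casselman1995, §6.4] [cite: Keys1984, §7 Theorem (2) p. 126] -/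
theorem integral_toFun_weyl_mul_eq [MeasurableSpace ↥(cmBorelTriple L 3 v).N] (μ : Measure ↥(cmBorelTriple L 3 v).N)
    (f : haveI := locallyCompactSpace_cmBorelU L 3 v
      Representation.SmoothInd (cmBorelTriple L 3 v).P
        (Representation.twist (((Representation.trivial ℂ ↥(torusU (conjLocal L (IsCMField.complexConj L) v) (cmLocalForm L 3 v)) ℂ).twist
            (cmTorusCharPair L v χ₁ χ₂)).comp (cmBorelTriple L 3 v).proj) (rootDeltaChar (cmBorelTriple L 3 v).P)))
    (heig : haveI := locallyCompactSpace_cmBorelU L 3 v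
      ∀ j ∈ I, Representation.smoothIndRep (cmBorelTriple L 3 v).P _ j f =
        (fun g : Gqs L v => if h : IsUnit (((g.val : GL (Fin 3) (LocalRing L v)) : Matrix (Fin 3) (Fin 3) (LocalRing L v)) 0 0) then ((χ₁ h.unit : ℂˣ) : ℂ) else 0) j • f)
    (h1g : f.toFun w₀ = 0) (hS : MeasurableSet {m : ↥(cmBorelTriple L 3 v).N | 1 < Valued.v (((((m : ↥(unitaryGroupOfForm (conjLocal L (IsCMField.complexConj L) v) (cmLocalForm L 3 v))) : GL (Fin 3) (LocalRing L v)) : Matrix (Fin 3) (Fin 3) (LocalRing L v)) 0 2) w)}) :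
    ∫ n : ↥(cmBorelTriple L 3 v).N, f.toFun (w₀ * (n : ↥(unitaryGroupOfForm (conjLocal L (IsCMField.complexConj L) v) (cmLocalForm L 3 v))) * 1) ∂μ = ((χ₂ ⟨-1, F0P3cStCharTSBigCellFactorisation.neg_one_mem_normOneUnits (conjLocal L (IsCMField.complexConj L) v)⟩ : ℂˣ) : ℂ) * f.toFun 1 * ∫ n in {m : ↥(cmBorelTriple L 3 v).N | 1 < Valued.v (((((m : ↥(unitaryGroupOfForm (conjLocal L (IsCMField.complexConj L) v) (cmLocalForm L 3 v))) : GL (Fin 3) (LocalRing L v)) : Matrix (Fin 3) (Fin 3) (LocalRing L v)) 0 2) w)},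
      (fun n : ↥(cmBorelTriple L 3 v).N =>
        if h : IsUnit ((((n : ↥(unitaryGroupOfForm (conjLocal L (IsCMField.complexConj L) v) (cmLocalForm L 3 v))) : GL (Fin 3) (LocalRing L v)) : Matrix (Fin 3) (Fin 3) (LocalRing L v)) 0 2) then
          ((((χ₁ (Units.map ((conjLocal L (IsCMField.complexConj L) v) : LocalRing L v →* LocalRing L v) h.unit))⁻¹ : ℂˣ) : ℂ) *
            ((((unitModulusChar (LocalRing L v) h.unit)⁻¹ : ℝ≥0) : ℝ) : ℂ))
        else 0) n ∂μ := by
  simp only [mul_one]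
  rw [← integral_indicator hS, ← integral_const_mul]
  exact integral_congr_ae (Filter.Eventually.of_forall fun n =>
    toFun_weyl_mul_eq_mul_indicator L v w hw eA heA hϖ g₁ hg₁ K0 K1 I hK0 hK1 hI w₀ hw₀ χ₁ χ₂ f heig h1g n)

open Classical in
include hw heA hϖ hg₁ hK0 hK1 hI hw₀ in
set_option maxHeartbeats 1600000 in
set_option synthInstance.maxHeartbeats 400000 in
-- as in §2
/-- **`n ↦ f(w₀ n)` is integrable** as soon as `F₀` is integrable on the Borel set `S_gt` (`f(w₀) = 0`): §2 makes it a constant multiple of `𝟙_{S_gt} F₀` — the letter `hi₁₁`.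
[cite: Casselman1995, §6.4] -/
theorem integrable_toFun_weyl_mul [MeasurableSpace ↥(cmBorelTriple L 3 v).N] (μ : Measure ↥(cmBorelTriple L 3 v).N)
    (f : haveI := locallyCompactSpace_cmBorelU L 3 v
      Representation.SmoothInd (cmBorelTriple L 3 v).P
        (Representation.twist (((Representation.trivial ℂ ↥(torusU (conjLocal L (IsCMField.complexConj L) v) (cmLocalForm L 3 v)) ℂ).twist
            (cmTorusCharPair L v χ₁ χ₂)).comp (cmBorelTriple L 3 v).proj) (rootDeltaChar (cmBorelTriple L 3 v).P)))
    (heig : haveI := locallyCompactSpace_cmBorelU L 3 v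
      ∀ j ∈ I, Representation.smoothIndRep (cmBorelTriple L 3 v).P _ j f =
        (fun g : Gqs L v => if h : IsUnit (((g.val : GL (Fin 3) (LocalRing L v)) : Matrix (Fin 3) (Fin 3) (LocalRing L v)) 0 0) then ((χ₁ h.unit : ℂˣ) : ℂ) else 0) j • f)
    (h1g : f.toFun w₀ = 0) (hS : MeasurableSet {m : ↥(cmBorelTriple L 3 v).N | 1 < Valued.v (((((m : ↥(unitaryGroupOfForm (conjLocal L (IsCMField.complexConj L) v) (cmLocalForm L 3 v))) : GL (Fin 3) (LocalRing L v)) : Matrix (Fin 3) (Fin 3) (LocalRing L v)) 0 2) w)})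
    (hint : IntegrableOn (fun n : ↥(cmBorelTriple L 3 v).N =>
        if h : IsUnit ((((n : ↥(unitaryGroupOfForm (conjLocal L (IsCMField.complexConj L) v) (cmLocalForm L 3 v))) : GL (Fin 3) (LocalRing L v)) : Matrix (Fin 3) (Fin 3) (LocalRing L v)) 0 2) then
          ((((χ₁ (Units.map ((conjLocal L (IsCMField.complexConj L) v) : LocalRing L v →* LocalRing L v) h.unit))⁻¹ : ℂˣ) : ℂ) *
            ((((unitModulusChar (LocalRing L v) h.unit)⁻¹ : ℝ≥0) : ℝ) : ℂ))
        else 0) {m : ↥(cmBorelTriple L 3 v).N | 1 < Valued.v (((((m : ↥(unitaryGroupOfForm (conjLocal L (IsCMField.complexConj L) v) (cmLocalForm L 3 v))) : GL (Fin 3) (LocalRing L v)) : Matrix (Fin 3) (Fin 3) (LocalRing L v)) 0 2) w)} μ) :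
    Integrable (fun n : ↥(cmBorelTriple L 3 v).N => f.toFun (w₀ * (n : ↥(unitaryGroupOfForm (conjLocal L (IsCMField.complexConj L) v) (cmLocalForm L 3 v))) * 1)) μ := by
  have hfun : (fun n : ↥(cmBorelTriple L 3 v).N => f.toFun (w₀ * (n : ↥(unitaryGroupOfForm (conjLocal L (IsCMField.complexConj L) v) (cmLocalForm L 3 v))) * 1)) = fun n => (((χ₂ ⟨-1, F0P3cStCharTSBigCellFactorisation.neg_one_mem_normOneUnits (conjLocal L (IsCMField.complexConj L) v)⟩ : ℂˣ) : ℂ) * f.toFun 1) * Set.indicator {m : ↥(cmBorelTriple L 3 v).N | 1 < Valued.v (((((m : ↥(unitaryGroupOfForm (conjLocal L (IsCMField.complexConj L) v) (cmLocalForm L 3 v))) : GL (Fin 3) (LocalRing L v)) : Matrix (Fin 3) (Fin 3) (LocalRing L v)) 0 2) w)}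
      (fun n : ↥(cmBorelTriple L 3 v).N =>
        if h : IsUnit ((((n : ↥(unitaryGroupOfForm (conjLocal L (IsCMField.complexConj L) v) (cmLocalForm L 3 v))) : GL (Fin 3) (LocalRing L v)) : Matrix (Fin 3) (Fin 3) (LocalRing L v)) 0 2) then
          ((((χ₁ (Units.map ((conjLocal L (IsCMField.complexConj L) v) : LocalRing L v →* LocalRing L v) h.unit))⁻¹ : ℂˣ) : ℂ) *
            ((((unitModulusChar (LocalRing L v) h.unit)⁻¹ : ℝ≥0) : ℝ) : ℂ))
        else 0) n := by
    funext n; rw [mul_one]; exact toFun_weyl_mul_eq_mul_indicator L v w hw eA heA hϖ g₁ hg₁ K0 K1 I hK0 hK1 hI w₀ hw₀ χ₁ χ₂ f heig h1g n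
  rw [hfun]
  exact ((integrable_indicator_iff hS).2 hint).const_mul _

open Classical in
include hw heA hϖ hg₁ hK0 hK1 hI hw₀ in
set_option maxHeartbeats 1600000 in
set_option synthInstance.maxHeartbeats 400000 in
-- as in §2
/-- **`Λ_{w₀} f = ∫_N f(w₀ n w₀) dμ = χ₂(−1)·f(w₀)·∫_{S_ge} F₀ dμ`** for `f(1) = 0` (`S_ge` Borel). [cite: Casselman1980, §3] [cite: Casselman1995, §6.4] [cite: Keys1984, §7 Theorem (2) p. 126] -/
theorem integral_toFun_conj_weyl_eq [MeasurableSpace ↥(cmBorelTriple L 3 v).N] (μ : Measure ↥(cmBorelTriple L 3 v).N)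
    (f : haveI := locallyCompactSpace_cmBorelU L 3 v
      Representation.SmoothInd (cmBorelTriple L 3 v).P
        (Representation.twist (((Representation.trivial ℂ ↥(torusU (conjLocal L (IsCMField.complexConj L) v) (cmLocalForm L 3 v)) ℂ).twist
            (cmTorusCharPair L v χ₁ χ₂)).comp (cmBorelTriple L 3 v).proj) (rootDeltaChar (cmBorelTriple L 3 v).P)))
    (heig : haveI := locallyCompactSpace_cmBorelU L 3 v
      ∀ j ∈ I, Representation.smoothIndRep (cmBorelTriple L 3 v).P _ j f =
        (fun g : Gqs L v => if h : IsUnit (((g.val : GL (Fin 3) (LocalRing L v)) : Matrix (Fin 3) (Fin 3) (LocalRing L v)) 0 0) then ((χ₁ h.unit : ℂˣ) : ℂ) else 0) j • f)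
    (hw1 : f.toFun 1 = 0) (hS : MeasurableSet {m : ↥(cmBorelTriple L 3 v).N | 1 ≤ Valued.v (((((m : ↥(unitaryGroupOfForm (conjLocal L (IsCMField.complexConj L) v) (cmLocalForm L 3 v))) : GL (Fin 3) (LocalRing L v)) : Matrix (Fin 3) (Fin 3) (LocalRing L v)) 0 2) w)}) :
    ∫ n : ↥(cmBorelTriple L 3 v).N, f.toFun (w₀ * (n : ↥(unitaryGroupOfForm (conjLocal L (IsCMField.complexConj L) v) (cmLocalForm L 3 v))) * w₀) ∂μ = ((χ₂ ⟨-1, F0P3cStCharTSBigCellFactorisation.neg_one_mem_normOneUnits (conjLocal L (IsCMField.complexConj L) v)⟩ : ℂˣ) : ℂ) * f.toFun w₀ * ∫ n in {m : ↥(cmBorelTriple L 3 v).N | 1 ≤ Valued.v (((((m : ↥(unitaryGroupOfForm (conjLocal L (IsCMField.complexConj L) v) (cmLocalForm L 3 v))) : GL (Fin 3) (LocalRing L v)) : Matrix (Fin 3) (Fin 3) (LocalRing L v)) 0 2) w)},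
      (fun n : ↥(cmBorelTriple L 3 v).N =>
        if h : IsUnit ((((n : ↥(unitaryGroupOfForm (conjLocal L (IsCMField.complexConj L) v) (cmLocalForm L 3 v))) : GL (Fin 3) (LocalRing L v)) : Matrix (Fin 3) (Fin 3) (LocalRing L v)) 0 2) then
          ((((χ₁ (Units.map ((conjLocal L (IsCMField.complexConj L) v) : LocalRing L v →* LocalRing L v) h.unit))⁻¹ : ℂˣ) : ℂ) *
            ((((unitModulusChar (LocalRing L v) h.unit)⁻¹ : ℝ≥0) : ℝ) : ℂ))
        else 0) n ∂μ := by
  rw [← integral_indicator hS, ← integral_const_mul]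
  exact integral_congr_ae (Filter.Eventually.of_forall fun n =>
    toFun_conj_weyl_eq_mul_indicator L v w hw eA heA hϖ g₁ hg₁ K0 K1 I hK0 hK1 hI w₀ hw₀ χ₁ χ₂ f heig hw1 n)

open Classical in
include hw heA hϖ hg₁ hK0 hK1 hI hw₀ in
set_option maxHeartbeats 1600000 in
set_option synthInstance.maxHeartbeats 400000 in
-- as in §2
/-- **`n ↦ f(w₀ n w₀)` is integrable** as soon as `F₀` is integrable on the Borel set `S_ge` (`f(1) = 0`) — the letter `hiw₂`. [cite: Casselman1995, §6.4] -/
theorem integrable_toFun_conj_weyl [MeasurableSpace ↥(cmBorelTriple L 3 v).N] (μ : Measure ↥(cmBorelTriple L 3 v).N)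
    (f : haveI := locallyCompactSpace_cmBorelU L 3 v
      Representation.SmoothInd (cmBorelTriple L 3 v).P
        (Representation.twist (((Representation.trivial ℂ ↥(torusU (conjLocal L (IsCMField.complexConj L) v) (cmLocalForm L 3 v)) ℂ).twist
            (cmTorusCharPair L v χ₁ χ₂)).comp (cmBorelTriple L 3 v).proj) (rootDeltaChar (cmBorelTriple L 3 v).P)))
    (heig : haveI := locallyCompactSpace_cmBorelU L 3 v
      ∀ j ∈ I, Representation.smoothIndRep (cmBorelTriple L 3 v).P _ j f =
        (fun g : Gqs L v => if h : IsUnit (((g.val : GL (Fin 3) (LocalRing L v)) : Matrix (Fin 3) (Fin 3) (LocalRing L v)) 0 0) then ((χ₁ h.unit : ℂˣ) : ℂ) else 0) j • f)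
    (hw1 : f.toFun 1 = 0) (hS : MeasurableSet {m : ↥(cmBorelTriple L 3 v).N | 1 ≤ Valued.v (((((m : ↥(unitaryGroupOfForm (conjLocal L (IsCMField.complexConj L) v) (cmLocalForm L 3 v))) : GL (Fin 3) (LocalRing L v)) : Matrix (Fin 3) (Fin 3) (LocalRing L v)) 0 2) w)})
    (hint : IntegrableOn (fun n : ↥(cmBorelTriple L 3 v).N =>
        if h : IsUnit ((((n : ↥(unitaryGroupOfForm (conjLocal L (IsCMField.complexConj L) v) (cmLocalForm L 3 v))) : GL (Fin 3) (LocalRing L v)) : Matrix (Fin 3) (Fin 3) (LocalRing L v)) 0 2) then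
          ((((χ₁ (Units.map ((conjLocal L (IsCMField.complexConj L) v) : LocalRing L v →* LocalRing L v) h.unit))⁻¹ : ℂˣ) : ℂ) *
            ((((unitModulusChar (LocalRing L v) h.unit)⁻¹ : ℝ≥0) : ℝ) : ℂ))
        else 0) {m : ↥(cmBorelTriple L 3 v).N | 1 ≤ Valued.v (((((m : ↥(unitaryGroupOfForm (conjLocal L (IsCMField.complexConj L) v) (cmLocalForm L 3 v))) : GL (Fin 3) (LocalRing L v)) : Matrix (Fin 3) (Fin 3) (LocalRing L v)) 0 2) w)} μ) :
    Integrable (fun n : ↥(cmBorelTriple L 3 v).N => f.toFun (w₀ * (n : ↥(unitaryGroupOfForm (conjLocal L (IsCMField.complexConj L) v) (cmLocalForm L 3 v))) * w₀)) μ := by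
  have hfun : (fun n : ↥(cmBorelTriple L 3 v).N => f.toFun (w₀ * (n : ↥(unitaryGroupOfForm (conjLocal L (IsCMField.complexConj L) v) (cmLocalForm L 3 v))) * w₀)) = fun n => (((χ₂ ⟨-1, F0P3cStCharTSBigCellFactorisation.neg_one_mem_normOneUnits (conjLocal L (IsCMField.complexConj L) v)⟩ : ℂˣ) : ℂ) * f.toFun w₀) * Set.indicator {m : ↥(cmBorelTriple L 3 v).N | 1 ≤ Valued.v (((((m : ↥(unitaryGroupOfForm (conjLocal L (IsCMField.complexConj L) v) (cmLocalForm L 3 v))) : GL (Fin 3) (LocalRing L v)) : Matrix (Fin 3) (Fin 3) (LocalRing L v)) 0 2) w)}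
      (fun n : ↥(cmBorelTriple L 3 v).N =>
        if h : IsUnit ((((n : ↥(unitaryGroupOfForm (conjLocal L (IsCMField.complexConj L) v) (cmLocalForm L 3 v))) : GL (Fin 3) (LocalRing L v)) : Matrix (Fin 3) (Fin 3) (LocalRing L v)) 0 2) then
          ((((χ₁ (Units.map ((conjLocal L (IsCMField.complexConj L) v) : LocalRing L v →* LocalRing L v) h.unit))⁻¹ : ℂˣ) : ℂ) *
            ((((unitModulusChar (LocalRing L v) h.unit)⁻¹ : ℝ≥0) : ℝ) : ℂ))
        else 0) n :=
    funext fun n => toFun_conj_weyl_eq_mul_indicator L v w hw eA heA hϖ g₁ hg₁ K0 K1 I hK0 hK1 hI w₀ hw₀ χ₁ χ₂ f heig hw1 n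
  rw [hfun]
  exact ((integrable_indicator_iff hS).2 hint).const_mul _

end Summit.HodgeConjecture.HodgeConjecture.Cruxes.H413.K2E3BranchBCasselmanPairEntries

end
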